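import Summits.CriticalPhenomena.PercolationContinuityZ3.Theorems.PercNearOneGluingNoHeavyLowerTailAPLTreeFourPointEdge
import HarnessLib

/-!
# `NoHeavyLowerTail` (stmt-CriticalPhenomena-4575) — the per-vertex inequality (PV) in the EASY REGIME `Δ_v ≤ 2 b⁰_v`,
# for bond percolation on every finite weighted graph

Support file (prover prim-ineq-gen-8 gen 44; `--supports stmt-CriticalPhenomena-4575`; memos
run/shared/lean/prim/prim-ineq-gen-8/FINDING-gen42-PERVERTEX.md §2c and FINDING-gen44-SIGNED.md).  No definitions, no named facts,
no sorries.  This is the first KERNEL theorem of the (V_w)/(PV) line that is a statement about the percolation measure itself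
(the earlier files `…APLVwStep/PerVertex/Layer.lean` are the real-algebra skeletons of the apex-edge induction).

SETTING.  `μ = prodBernoulli w` on the pairs of a finite vertex type `V` (arbitrary edge weights), a glued apex SET `S`
(`I(x) = {S ~ x} = ⋃ u ∈ S, {u ↔ x}`), a vertex `v`, loads `ℓ : V → ℝ`, `ℓ ≥ 0`.  Write `K` for the glued cluster of `S`,
`A = Σ_x ℓ_x 1[S ~ x]` (the load of `K`; loads on `S` contribute constants), `Z_v = 1[S ≁ v] · Σ_y ℓ_y 1[v ↔ y]` (the load of the
cluster of `v` when it is not glued), `p_v = μ(S ~ v)`, and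
  `N  := Cov(1[S~v], A)      = Σ_x ℓ_x (μ(S~v, S~x) − μ(S~v) μ(S~x))`,
  `Γ  := −Cov(A, Z_v)        = Σ_{x,y} ℓ_x ℓ_y (μ(S~x) μ(v↔y, S≁v) − μ(S~x, v↔y, S≁v))`,
  `s  := E[Z_v] = (1−p_v) b⁰_v = Σ_y ℓ_y μ(v↔y, S≁v)`,   `b⁰_v = E[ℓ(C_v) | S ≁ v]`,   `Δ_v = N / p_v` (the boost).
The per-vertex conjecture (PV) of gen 42 is `N² ≤ 2 p_v Γ` (equivalently `T_v := N²/p_v − 2Γ ≤ 0`); summed with weights `ℓ_v` it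
gives (V_w), hence (V) and, with the proved (P) (`APL.kappa3_add_three_cov_nonpos`), (Q0).

THIS FILE proves, for every finite weighted graph:
* `reach_conn_cond_neg_corr` — the event row `μ(S≁v) · μ(S~x, v↔y, S≁v) ≤ μ(S~x, S≁v) · μ(v↔y, S≁v)`: given that `v` is not
  glued, the glued cluster and the cluster of `v` are negatively correlated (van den Berg–Häggström–Kahn 2006 Thm 2.1 for the
  sets `{v}`, `S`, through `Literature.Probability.Percolation.TwoSetExchange.setTwoClusterExchange`);
* `pv_gamma_nonneg` — `Γ ≥ 0`, i.e. `Cov(A, Z_v) ≤ 0` (so `2|Cov(L,R)| = 2Σ_v ℓ_v Γ_v` in (V_w) is a sum of nonnegative terms);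
* `pv_easy_alg` — the real-algebra step: the event row + `(1−p_v) N ≤ 2 p_v s` + `N ≥ 0` give `N² ≤ 2 p_v Γ`;
* **`pv_easy_regime`** — (PV) `N² ≤ 2 p_v Γ` at every vertex `v` with `(1−p_v)·N ≤ 2 p_v·s`, i.e. with `Δ_v ≤ 2 b⁰_v`
  ("easy regime" of memo gen 42 §2c(i); numerically ≈ 95 % of (instance, vertex) pairs).
Proof of the last: by the event row, `(1−p_v) Γ ≥ N·s`; multiply the hypothesis by `N ≥ 0` (Harris).  The complementary HARD regime
`Δ_v > 2 b⁰_v` needs the quantitative negative correlation `−Cov(ℓ(C_S), ℓ(C_v) | S≁v) ≥ [p_v/(1−p_v)] Δ_v (½Δ_v − b⁰_v)` and is open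
(memo gen 44: it is the PSD statement `c cᵀ ⪯ 2 p_v Sym K` there, 0 failures). [this work]
-/

noncomputable section

namespace Summit.CriticalPhenomena.PercolationContinuityZ3.Theorems

namespace APL

open MeasureTheory Set Finset Literature.Probability.Percolation Literature.Probability.LatticeModels
  Literature.Probability.Percolation.TwoSetExchange
open scoped Classical BigOperators

variable {V : Type*}

/-! ### Real algebra: the easy-regime step -/

/-- **Easy-regime algebra.**  For reals indexed by a finite set `U`: if `0 ≤ p_v < 1`, `ℓ ≥ 0`,
the event row `(1 − p_v) ρ_{xy} ≤ (p_x − π_x) σ_y` holds for all `x, y`, `N := Σ_x ℓ_x (π_x − p_v p_x) ≥ 0` and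
`(1 − p_v) N ≤ 2 p_v Σ_y ℓ_y σ_y`, then `N² ≤ 2 p_v Σ_{x,y} ℓ_x ℓ_y (p_x σ_y − ρ_{xy})`.
(Read `π_x = μ(S~v, S~x)`, `p_x = μ(S~x)`, `σ_y = μ(v↔y, S≁v)`, `ρ_{xy} = μ(S~x, v↔y, S≁v)`.) [this work] -/
theorem pv_easy_alg {ι : Type*} (U : Finset ι) (ℓ p π σ : ι → ℝ) (ρ : ι → ι → ℝ) (pv : ℝ)
    (hpv0 : 0 ≤ pv) (hpv1 : pv < 1) (hℓ : ∀ x ∈ U, 0 ≤ ℓ x)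
    (hrow : ∀ x ∈ U, ∀ y ∈ U, (1 - pv) * ρ x y ≤ (p x - π x) * σ y)
    (hN : 0 ≤ ∑ x ∈ U, ℓ x * (π x - pv * p x))
    (heasy : (1 - pv) * ∑ x ∈ U, ℓ x * (π x - pv * p x) ≤ 2 * pv * ∑ y ∈ U, ℓ y * σ y) :
    (∑ x ∈ U, ℓ x * (π x - pv * p x)) ^ 2 ≤
      2 * pv * ∑ x ∈ U, ∑ y ∈ U, ℓ x * ℓ y * (p x * σ y - ρ x y) := by
  set N := ∑ x ∈ U, ℓ x * (π x - pv * p x) with hNdef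
  set s := ∑ y ∈ U, ℓ y * σ y with hsdef
  set Γ := ∑ x ∈ U, ∑ y ∈ U, ℓ x * ℓ y * (p x * σ y - ρ x y) with hΓdef
  -- step 1: `N s ≤ (1 - pv) Γ`, termwise from the event row
  have h1 : N * s ≤ (1 - pv) * Γ := by
    rw [hNdef, hsdef, hΓdef, Finset.sum_mul_sum, Finset.mul_sum]
    refine Finset.sum_le_sum fun x hx => ?_
    rw [Finset.mul_sum]
    refine Finset.sum_le_sum fun y hy => ?_
    have hl : 0 ≤ ℓ x * ℓ y := mul_nonneg (hℓ x hx) (hℓ y hy)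
    have h := mul_le_mul_of_nonneg_left (hrow x hx y hy) hl
    nlinarith [h]
  -- step 2: multiply the hypothesis by `N ≥ 0`
  have h2 : (1 - pv) * N * N ≤ 2 * pv * s * N := mul_le_mul_of_nonneg_right heasy hN
  have h3 : 2 * pv * (N * s) ≤ 2 * pv * ((1 - pv) * Γ) := mul_le_mul_of_nonneg_left h1 (by positivity)
  have h4 : (1 - pv) * N ^ 2 ≤ (1 - pv) * (2 * pv * Γ) := by nlinarith [h2, h3]
  exact le_of_mul_le_mul_left h4 (by linarith)

/-! ### The event row: conditional negative correlation of the glued cluster and the cluster of `v` -/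

section Perc

variable [Fintype V] (w : Sym2 V → unitInterval) (S : Set V) (v : V)

/-- **Conditional negative correlation (BHK).**  `μ(S≁v) · μ({S~x} ∩ {v↔y} ∩ {S≁v}) ≤ μ({S~x} ∩ {S≁v}) · μ({v↔y} ∩ {S≁v})`:
given that `v` is not glued to `S`, the events "`S` reaches `x`" (increasing in the glued cluster) and "`v` reaches `y`"
(increasing in the cluster of `v`) are negatively correlated.  This is van den Berg–Häggström–Kahn 2006, Thm 2.1 (sets `{v}`, `S`;
`1[v↔y]` of type (+), `1[S~x]` of type (−)), read off `setTwoClusterExchange` with two trivial events.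
[cite: VandenbergHaggstromKahn2005, Thm. 2.1 (p. 9) — instance, derived here] -/
theorem reach_conn_cond_neg_corr (x y : V) :
    (prodBernoulli w).real (⋃ u ∈ S, (openConn u v : Set (BondConfig V)))ᶜ *
        (prodBernoulli w).real ((⋃ u ∈ S, (openConn u x : Set (BondConfig V))) ∩ (openConn v y : Set (BondConfig V))
          ∩ (⋃ u ∈ S, (openConn u v : Set (BondConfig V)))ᶜ) ≤
      (prodBernoulli w).real ((⋃ u ∈ S, (openConn u x : Set (BondConfig V))) ∩ (⋃ u ∈ S, (openConn u v : Set (BondConfig V)))ᶜ) *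
        (prodBernoulli w).real ((openConn v y : Set (BondConfig V)) ∩ (⋃ u ∈ S, (openConn u v : Set (BondConfig V)))ᶜ) := by
  have hvv : v ∈ ({v} : Set V) := mem_singleton v
  have key := setTwoClusterExchange w ({v} : Set V) S
    (A₁ := (Set.univ : Set (BondConfig V))) (A₂ := (openConn v y : Set (BondConfig V)))
    (B₁ := (Set.univ : Set (BondConfig V))) (B₂ := ⋃ u ∈ S, (openConn u x : Set (BondConfig V)))
    (fun _ _ _ _ _ => Set.mem_univ _)
    (fun _ _ hs' ht' h => typePlus_openConn_of_mem ({v} : Set V) S hvv y hs' ht' h)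
    (fun _ _ _ _ _ => Set.mem_univ _)
    (fun _ _ hs' ht' h => typeMinus_biUnion_openConn ({v} : Set V) S x hs' ht' h)
  rw [bhkQ_single_eq] at key
  simp only [Set.univ_inter, Set.inter_univ] at key
  set Q := (⋃ u ∈ S, (openConn u v : Set (BondConfig V)))ᶜ
  set Ix := (⋃ u ∈ S, (openConn u x : Set (BondConfig V)))
  set Ty := (openConn v y : Set (BondConfig V))
  have e1 : Ix ∩ Ty ∩ Q = Q ∩ (Ty ∩ Ix) := by ext ω; simp only [Set.mem_inter_iff]; tauto
  have e2 : Ix ∩ Q = Q ∩ Ix := Set.inter_comm _ _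
  have e3 : Ty ∩ Q = Q ∩ Ty := Set.inter_comm _ _
  rw [e1, e2, e3, mul_comm ((prodBernoulli w).real (Q ∩ Ix))]
  exact key

/-- **`Γ ≥ 0`, i.e. `Cov(A, Z_v) ≤ 0`** for nonnegative loads: `Σ_{x,y} ℓ_x ℓ_y (μ(S~x) μ(v↔y, S≁v) − μ(S~x, v↔y, S≁v)) ≥ 0`.
Termwise this is the cross row `μ(S~x, v↔y, S≁v) ≤ μ(S~x) μ(v↔y, S≁v)` (`APL.cross_row`, BHK + Harris). [this work] -/
theorem pv_gamma_nonneg (ℓ : V → ℝ) (hℓ : ∀ x, 0 ≤ ℓ x) :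
    0 ≤ ∑ x, ∑ y, ℓ x * ℓ y *
      ((prodBernoulli w).real (⋃ u ∈ S, (openConn u x : Set (BondConfig V))) *
          (prodBernoulli w).real ((openConn v y : Set (BondConfig V)) ∩ (⋃ u ∈ S, (openConn u v : Set (BondConfig V)))ᶜ) -
        (prodBernoulli w).real ((⋃ u ∈ S, (openConn u x : Set (BondConfig V))) ∩ (openConn v y : Set (BondConfig V))
          ∩ (⋃ u ∈ S, (openConn u v : Set (BondConfig V)))ᶜ)) := by
  refine Finset.sum_nonneg fun x _ => Finset.sum_nonneg fun y _ => ?_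
  have h := cross_row w S v x y
  exact mul_nonneg (mul_nonneg (hℓ x) (hℓ y)) (by linarith)

/-- **(PV) in the easy regime `Δ_v ≤ 2 b⁰_v`.**  For bond percolation `prodBernoulli w` on a finite weighted graph, a glued
apex set `S`, a vertex `v` and loads `ℓ ≥ 0`, write `p_v = μ(S~v)`, `N = Σ_x ℓ_x (μ(S~v ∩ S~x) − p_v μ(S~x)) = Cov(1[S~v], A)`,
`s = Σ_y ℓ_y μ(v↔y ∩ S≁v) = E[Z_v]` and `Γ = Σ_{x,y} ℓ_x ℓ_y (μ(S~x) μ(v↔y ∩ S≁v) − μ(S~x ∩ v↔y ∩ S≁v)) = −Cov(A, Z_v)`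
(`A = Σ_x ℓ_x 1[S~x]`, `Z_v = 1[S≁v] Σ_y ℓ_y 1[v↔y]`).  If `(1 − p_v) N ≤ 2 p_v s` — i.e. the boost `Δ_v = N/p_v` is at most twice
`b⁰_v = E[ℓ(C_v) | S≁v] = s/(1−p_v)` — then `N² ≤ 2 p_v Γ`, i.e. `Cov(1[S~v], A)² ≤ 2 μ(S~v) · (−Cov(A, Z_v))`:
the per-vertex inequality (PV) of memo gen 42 holds at `v`. [this work] -/
theorem pv_easy_regime (ℓ : V → ℝ) (hℓ : ∀ x, 0 ≤ ℓ x)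
    (heasy : (1 - (prodBernoulli w).real (⋃ u ∈ S, (openConn u v : Set (BondConfig V)))) *
        ∑ x, ℓ x * ((prodBernoulli w).real ((⋃ u ∈ S, (openConn u v : Set (BondConfig V))) ∩
              (⋃ u ∈ S, (openConn u x : Set (BondConfig V)))) -
            (prodBernoulli w).real (⋃ u ∈ S, (openConn u v : Set (BondConfig V))) *
              (prodBernoulli w).real (⋃ u ∈ S, (openConn u x : Set (BondConfig V)))) ≤
      2 * (prodBernoulli w).real (⋃ u ∈ S, (openConn u v : Set (BondConfig V))) *
        ∑ y, ℓ y * (prodBernoulli w).real ((openConn v y : Set (BondConfig V)) ∩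
          (⋃ u ∈ S, (openConn u v : Set (BondConfig V)))ᶜ)) :
    (∑ x, ℓ x * ((prodBernoulli w).real ((⋃ u ∈ S, (openConn u v : Set (BondConfig V))) ∩
            (⋃ u ∈ S, (openConn u x : Set (BondConfig V)))) -
          (prodBernoulli w).real (⋃ u ∈ S, (openConn u v : Set (BondConfig V))) *
            (prodBernoulli w).real (⋃ u ∈ S, (openConn u x : Set (BondConfig V))))) ^ 2 ≤
      2 * (prodBernoulli w).real (⋃ u ∈ S, (openConn u v : Set (BondConfig V))) *
        ∑ x, ∑ y, ℓ x * ℓ y *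
          ((prodBernoulli w).real (⋃ u ∈ S, (openConn u x : Set (BondConfig V))) *
              (prodBernoulli w).real ((openConn v y : Set (BondConfig V)) ∩ (⋃ u ∈ S, (openConn u v : Set (BondConfig V)))ᶜ) -
            (prodBernoulli w).real ((⋃ u ∈ S, (openConn u x : Set (BondConfig V))) ∩ (openConn v y : Set (BondConfig V))
              ∩ (⋃ u ∈ S, (openConn u v : Set (BondConfig V)))ᶜ)) := by
  -- names
  set μ := prodBernoulli w with hμ
  haveI : IsProbabilityMeasure μ := by rw [hμ]; infer_instance
  set Iv := (⋃ u ∈ S, (openConn u v : Set (BondConfig V))) with hIv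
  set pv := μ.real Iv with hpv
  -- the events `I x` are increasing
  have hup : ∀ x : V, IsUpperSet (⋃ u ∈ S, (openConn u x : Set (BondConfig V))) := by
    intro x ω ω' hle hω
    simp only [Set.mem_iUnion, exists_prop] at hω ⊢
    obtain ⟨u, hu, hux⟩ := hω
    exact ⟨u, hu, isUpperSet_openConn u x hle hux⟩
  -- Harris: `pv μ(I x) ≤ μ(I v ∩ I x)`, hence `N ≥ 0`
  have hHar : ∀ x : V, pv * μ.real (⋃ u ∈ S, (openConn u x : Set (BondConfig V))) ≤
      μ.real (Iv ∩ ⋃ u ∈ S, (openConn u x : Set (BondConfig V))) := fun x =>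
    prodBernoulli_harris w (hup v) (hup x) MeasurableSet.of_discrete MeasurableSet.of_discrete
  have hN : 0 ≤ ∑ x, ℓ x * (μ.real (Iv ∩ ⋃ u ∈ S, (openConn u x : Set (BondConfig V))) -
      pv * μ.real (⋃ u ∈ S, (openConn u x : Set (BondConfig V)))) :=
    Finset.sum_nonneg fun x _ => mul_nonneg (hℓ x) (by linarith [hHar x])
  -- `μ(I x ∩ Q) = μ(I x) − μ(I v ∩ I x)`
  have hsplit : ∀ x : V, μ.real ((⋃ u ∈ S, (openConn u x : Set (BondConfig V))) ∩ Ivᶜ) =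
      μ.real (⋃ u ∈ S, (openConn u x : Set (BondConfig V))) - μ.real (Iv ∩ ⋃ u ∈ S, (openConn u x : Set (BondConfig V))) := by
    intro x
    have h := measureReal_inter_add_sdiff (μ := μ) (s := ⋃ u ∈ S, (openConn u x : Set (BondConfig V))) (t := Iv)
      MeasurableSet.of_discrete (measure_ne_top μ _)
    rw [Set.sdiff_eq, Set.inter_comm _ Iv] at h
    linarith
  have hQ : μ.real Ivᶜ = 1 - pv := probReal_compl_eq_one_sub MeasurableSet.of_discrete
  have hle : pv ≤ 1 := measureReal_le_one
  rcases hle.lt_or_eq with hlt | heq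
  · -- `pv < 1`: the algebraic step
    refine pv_easy_alg Finset.univ ℓ (fun x => μ.real (⋃ u ∈ S, (openConn u x : Set (BondConfig V))))
      (fun x => μ.real (Iv ∩ ⋃ u ∈ S, (openConn u x : Set (BondConfig V))))
      (fun y => μ.real ((openConn v y : Set (BondConfig V)) ∩ Ivᶜ))
      (fun x y => μ.real ((⋃ u ∈ S, (openConn u x : Set (BondConfig V))) ∩ (openConn v y : Set (BondConfig V)) ∩ Ivᶜ))
      pv measureReal_nonneg hlt (fun x _ => hℓ x) (fun x _ y _ => ?_) hN heasy
    -- the event row, with `μ(I x ∩ Q) = p_x − π_x`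
    have h := reach_conn_cond_neg_corr w S v x y
    rw [← hμ, ← hIv, hQ, hsplit x] at h
    simpa only [hpv] using h
  · -- `pv = 1`: both sides vanish
    have hQ0 : μ.real Ivᶜ = 0 := by rw [hQ, heq, sub_self]
    have hσ : ∀ y : V, μ.real ((openConn v y : Set (BondConfig V)) ∩ Ivᶜ) = 0 := fun y =>
      le_antisymm ((measureReal_mono Set.inter_subset_right (measure_ne_top μ _)).trans hQ0.le) measureReal_nonneg
    have hρ : ∀ x y : V, μ.real ((⋃ u ∈ S, (openConn u x : Set (BondConfig V))) ∩ (openConn v y : Set (BondConfig V))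
        ∩ Ivᶜ) = 0 := fun x y =>
      le_antisymm ((measureReal_mono Set.inter_subset_right (measure_ne_top μ _)).trans hQ0.le) measureReal_nonneg
    have hN0 : ∑ x, ℓ x * (μ.real (Iv ∩ ⋃ u ∈ S, (openConn u x : Set (BondConfig V))) -
        pv * μ.real (⋃ u ∈ S, (openConn u x : Set (BondConfig V)))) = 0 := by
      refine le_antisymm ?_ hN
      refine Finset.sum_nonpos fun x _ => mul_nonpos_of_nonneg_of_nonpos (hℓ x) ?_
      have hx : μ.real (Iv ∩ ⋃ u ∈ S, (openConn u x : Set (BondConfig V))) ≤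
          μ.real (⋃ u ∈ S, (openConn u x : Set (BondConfig V))) :=
        measureReal_mono Set.inter_subset_right (measure_ne_top μ _)
      rw [heq, one_mul]
      linarith
    rw [hN0]
    simp only [hσ, hρ, mul_zero, sub_zero, Finset.sum_const_zero]
    norm_num

/-! ### Appendix (gen 44, second landing): the exact hard-regime reduction

With `C_D := Σ_{x,y} ℓ_x ℓ_y ((1−p_v) ρ_{xy} − (p_x − π_x) σ_y) = μ(S≁v)² · Cov(A, ℓ(C_v) | S≁v) ≤ 0` (the event row summed),
the EXACT identity `(1 − p_v) Γ = N·s − C_D` holds (no sign assumptions), so (PV) `N² ≤ 2 p_v Γ` is EQUIVALENT (for `p_v < 1`) to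
`(1−p_v) N² − 2 p_v N s ≤ −2 p_v C_D`, i.e. to the quantitative conditional negative correlation
`−Cov(ℓ(C_S), ℓ(C_v) | S≁v) ≥ [p_v/(1−p_v)] Δ_v (½Δ_v − b⁰_v)` of memo gen 42 §2c(ii) — trivial in the easy regime (left side ≤ 0),
the open HARD regime otherwise.  The theorems below put this reduction in the kernel. [this work] -/

/-- **The `Γ`-identity.**  `(1 − p_v)·Σ_{x,y} ℓ_xℓ_y (p_x σ_y − ρ_{xy}) = (Σ_x ℓ_x (π_x − p_v p_x))·(Σ_y ℓ_y σ_y) − Σ_{x,y} ℓ_xℓ_y ((1−p_v)ρ_{xy} − (p_x − π_x)σ_y)`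
(pure algebra; in the percolation reading `(1−p_v)Γ = N s − μ(S≁v)²·Cov(A, ℓ(C_v) | S≁v)`). [this work] -/
theorem pv_gamma_identity {ι : Type*} (U : Finset ι) (ℓ p π σ : ι → ℝ) (ρ : ι → ι → ℝ) (pv : ℝ) :
    (1 - pv) * ∑ x ∈ U, ∑ y ∈ U, ℓ x * ℓ y * (p x * σ y - ρ x y) =
      (∑ x ∈ U, ℓ x * (π x - pv * p x)) * (∑ y ∈ U, ℓ y * σ y) -
        ∑ x ∈ U, ∑ y ∈ U, ℓ x * ℓ y * ((1 - pv) * ρ x y - (p x - π x) * σ y) := by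
  rw [Finset.sum_mul_sum, ← Finset.sum_sub_distrib, Finset.mul_sum]
  refine Finset.sum_congr rfl fun x _ => ?_
  rw [← Finset.sum_sub_distrib, Finset.mul_sum]
  refine Finset.sum_congr rfl fun y _ => ?_
  ring

/-- **Hard-regime reduction (algebra).**  If `p_v < 1` and `(1−p_v) N² − 2 p_v N s ≤ −2 p_v C_D`, where
`N = Σ_x ℓ_x (π_x − p_v p_x)`, `s = Σ_y ℓ_y σ_y`, `C_D = Σ_{x,y} ℓ_xℓ_y ((1−p_v)ρ_{xy} − (p_x − π_x)σ_y)`, then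
`N² ≤ 2 p_v Σ_{x,y} ℓ_xℓ_y (p_x σ_y − ρ_{xy})`.  No sign assumptions on `ℓ`. [this work] -/
theorem pv_of_cond_cov_alg {ι : Type*} (U : Finset ι) (ℓ p π σ : ι → ℝ) (ρ : ι → ι → ℝ) (pv : ℝ) (hpv1 : pv < 1)
    (hcov : (1 - pv) * (∑ x ∈ U, ℓ x * (π x - pv * p x)) ^ 2
        - 2 * pv * (∑ x ∈ U, ℓ x * (π x - pv * p x)) * (∑ y ∈ U, ℓ y * σ y) ≤
      -2 * pv * ∑ x ∈ U, ∑ y ∈ U, ℓ x * ℓ y * ((1 - pv) * ρ x y - (p x - π x) * σ y)) :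
    (∑ x ∈ U, ℓ x * (π x - pv * p x)) ^ 2 ≤
      2 * pv * ∑ x ∈ U, ∑ y ∈ U, ℓ x * ℓ y * (p x * σ y - ρ x y) := by
  have hid := pv_gamma_identity U ℓ p π σ ρ pv
  set N := ∑ x ∈ U, ℓ x * (π x - pv * p x)
  set s := ∑ y ∈ U, ℓ y * σ y
  set Γ := ∑ x ∈ U, ∑ y ∈ U, ℓ x * ℓ y * (p x * σ y - ρ x y)
  set C := ∑ x ∈ U, ∑ y ∈ U, ℓ x * ℓ y * ((1 - pv) * ρ x y - (p x - π x) * σ y)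
  have h4 : (1 - pv) * N ^ 2 ≤ (1 - pv) * (2 * pv * Γ) := by nlinarith [hid, hcov]
  exact le_of_mul_le_mul_left h4 (by linarith)

/-- **(PV) from a quantitative conditional negative correlation (the hard-regime reduction, percolation form).**
In the notation of `pv_easy_regime`, let moreover
`C_D := Σ_{x,y} ℓ_xℓ_y (μ(S≁v)·μ(S~x ∩ v↔y ∩ S≁v) − μ(S~x ∩ S≁v)·μ(v↔y ∩ S≁v)) = μ(S≁v)²·Cov(A, ℓ(C_v) | S≁v)`
(`≤ 0` by `reach_conn_cond_neg_corr` when `ℓ ≥ 0`).  If `μ(S~v) < 1` and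
`(1 − p_v) N² − 2 p_v N s ≤ −2 p_v C_D` — i.e. `−Cov(A, ℓ(C_v) | S≁v) ≥ [p_v/(1−p_v)]·Δ_v·(½Δ_v − b⁰_v)` —
then (PV) `N² ≤ 2 p_v Γ` holds at `v`.  For nonnegative loads this contains `pv_easy_regime` (there the left side is
`≤ 0 ≤ −2 p_v C_D`); in the hard regime `Δ_v > 2 b⁰_v` it is the exact remaining target (memo gen 42 §2c(ii), gen 44). [this work] -/
theorem pv_of_cond_cov_bound (ℓ : V → ℝ)
    (hlt : (prodBernoulli w).real (⋃ u ∈ S, (openConn u v : Set (BondConfig V))) < 1)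
    (hcov : (1 - (prodBernoulli w).real (⋃ u ∈ S, (openConn u v : Set (BondConfig V)))) *
          (∑ x, ℓ x * ((prodBernoulli w).real ((⋃ u ∈ S, (openConn u v : Set (BondConfig V))) ∩
                (⋃ u ∈ S, (openConn u x : Set (BondConfig V)))) -
              (prodBernoulli w).real (⋃ u ∈ S, (openConn u v : Set (BondConfig V))) *
                (prodBernoulli w).real (⋃ u ∈ S, (openConn u x : Set (BondConfig V))))) ^ 2
        - 2 * (prodBernoulli w).real (⋃ u ∈ S, (openConn u v : Set (BondConfig V))) *
          (∑ x, ℓ x * ((prodBernoulli w).real ((⋃ u ∈ S, (openConn u v : Set (BondConfig V))) ∩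
                (⋃ u ∈ S, (openConn u x : Set (BondConfig V)))) -
              (prodBernoulli w).real (⋃ u ∈ S, (openConn u v : Set (BondConfig V))) *
                (prodBernoulli w).real (⋃ u ∈ S, (openConn u x : Set (BondConfig V))))) *
          (∑ y, ℓ y * (prodBernoulli w).real ((openConn v y : Set (BondConfig V)) ∩
            (⋃ u ∈ S, (openConn u v : Set (BondConfig V)))ᶜ)) ≤
      -2 * (prodBernoulli w).real (⋃ u ∈ S, (openConn u v : Set (BondConfig V))) *
        ∑ x, ∑ y, ℓ x * ℓ y *
          ((1 - (prodBernoulli w).real (⋃ u ∈ S, (openConn u v : Set (BondConfig V)))) *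
              (prodBernoulli w).real ((⋃ u ∈ S, (openConn u x : Set (BondConfig V))) ∩ (openConn v y : Set (BondConfig V))
                ∩ (⋃ u ∈ S, (openConn u v : Set (BondConfig V)))ᶜ) -
            ((prodBernoulli w).real (⋃ u ∈ S, (openConn u x : Set (BondConfig V))) -
                (prodBernoulli w).real ((⋃ u ∈ S, (openConn u v : Set (BondConfig V))) ∩
                  (⋃ u ∈ S, (openConn u x : Set (BondConfig V))))) *
              (prodBernoulli w).real ((openConn v y : Set (BondConfig V)) ∩ (⋃ u ∈ S, (openConn u v : Set (BondConfig V)))ᶜ))) :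
    (∑ x, ℓ x * ((prodBernoulli w).real ((⋃ u ∈ S, (openConn u v : Set (BondConfig V))) ∩
            (⋃ u ∈ S, (openConn u x : Set (BondConfig V)))) -
          (prodBernoulli w).real (⋃ u ∈ S, (openConn u v : Set (BondConfig V))) *
            (prodBernoulli w).real (⋃ u ∈ S, (openConn u x : Set (BondConfig V))))) ^ 2 ≤
      2 * (prodBernoulli w).real (⋃ u ∈ S, (openConn u v : Set (BondConfig V))) *
        ∑ x, ∑ y, ℓ x * ℓ y *
          ((prodBernoulli w).real (⋃ u ∈ S, (openConn u x : Set (BondConfig V))) *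
              (prodBernoulli w).real ((openConn v y : Set (BondConfig V)) ∩ (⋃ u ∈ S, (openConn u v : Set (BondConfig V)))ᶜ) -
            (prodBernoulli w).real ((⋃ u ∈ S, (openConn u x : Set (BondConfig V))) ∩ (openConn v y : Set (BondConfig V))
              ∩ (⋃ u ∈ S, (openConn u v : Set (BondConfig V)))ᶜ)) :=
  pv_of_cond_cov_alg Finset.univ ℓ (fun x => (prodBernoulli w).real (⋃ u ∈ S, (openConn u x : Set (BondConfig V))))
    (fun x => (prodBernoulli w).real ((⋃ u ∈ S, (openConn u v : Set (BondConfig V))) ∩ ⋃ u ∈ S, (openConn u x : Set (BondConfig V))))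
    (fun y => (prodBernoulli w).real ((openConn v y : Set (BondConfig V)) ∩ (⋃ u ∈ S, (openConn u v : Set (BondConfig V)))ᶜ))
    (fun x y => (prodBernoulli w).real ((⋃ u ∈ S, (openConn u x : Set (BondConfig V))) ∩ (openConn v y : Set (BondConfig V))
      ∩ (⋃ u ∈ S, (openConn u v : Set (BondConfig V)))ᶜ))
    _ hlt hcov

/-! ### Appendix 2 (gen 44, third landing): the apex-free master form (N1) gives (PV) with constant 4

(N1) (memo gen 44 §2e): for two vertices `y, v` and EVERY real `ℓ`, `E[ℓ(C_y)ℓ(C_v); y≁v] ≤ E[ℓ(C_y)]·E[ℓ(C_v)]` — a positive-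
semidefiniteness strengthening of the disjoint-clusters BK inequality, numerically without exception.  Taking `y = s` (the glued apex) and
adding a load `t` on the apex, (N1) reads, in the event sums of this file (`τ_v(y) = μ(v↔y) = σ_y + π^v_y` with `π^v_y = μ(S~v ∩ S~y)`),
`Σ_{x,y} ℓ_xℓ_y ρ_{xy} + t·s ≤ (a + t)(b + t p_v)` for all real `t` (`a = Σℓ_xp_x`, `b = Σℓ_yμ(v↔y)`, `s = Σℓ_yσ_y`), and the discriminant of
this quadratic in `t` is exactly `(PV) with constant 4`: `N² ≤ 4 p_v Γ`.  So a proof of (N1) would give `T_v ≤ ½ N²/p_v`, `W ≤ 4|Cov(L,R)|` and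
`Var(L)² ≤ 4 E[L]·|Cov(L,R)|` on every finite weighted graph (the conjectured constant is 2). [this work] -/

/-- Discriminant: if `0 < p` and `p t² + B t + C ≥ 0` for all real `t`, then `B² ≤ 4 p C`. [folklore] -/
theorem quad_nonneg_discr (p B C : ℝ) (hp : 0 < p) (h : ∀ t : ℝ, 0 ≤ p * t ^ 2 + B * t + C) : B ^ 2 ≤ 4 * p * C := by
  have h1 := h (-B / (2 * p))
  have hp' : p ≠ 0 := ne_of_gt hp
  have e : p * (-B / (2 * p)) ^ 2 + B * (-B / (2 * p)) + C = C - B ^ 2 / (4 * p) := by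
    field_simp
    ring
  rw [e] at h1
  have h2 : B ^ 2 / (4 * p) ≤ C := by linarith
  have h3 := (div_le_iff₀ (show (0:ℝ) < 4 * p by positivity)).1 h2
  linarith

/-- **(N1) at the apex ⟹ (PV) with constant 4 (algebra).**  With `a = Σ_x ℓ_x p_x`, `π̄ = Σ_y ℓ_y π_y`, `s = Σ_y ℓ_y σ_y`,
`E = Σ_{x,y} ℓ_xℓ_y ρ_{xy}`: if `0 < p_v` and `E + t s ≤ (a + t)(π̄ + s + t p_v)` for every real `t` (this is (N1) for the pair (apex, `v`)
with an extra load `t` on the apex, since `μ(v↔y) = σ_y + π_y`), then `N² ≤ 4 p_v Γ` with `N = π̄ − p_v a = Σ_x ℓ_x(π_x − p_v p_x)` and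
`Γ = a s − E = Σ_{x,y} ℓ_xℓ_y (p_xσ_y − ρ_{xy})`.  No sign assumptions on `ℓ`. [this work] -/
theorem pv_four_of_n1_alg {ι : Type*} (U : Finset ι) (ℓ p π σ : ι → ℝ) (ρ : ι → ι → ℝ) (pv : ℝ) (hpv : 0 < pv)
    (hN1 : ∀ t : ℝ, (∑ x ∈ U, ∑ y ∈ U, ℓ x * ℓ y * ρ x y) + t * ∑ y ∈ U, ℓ y * σ y ≤
      ((∑ x ∈ U, ℓ x * p x) + t) * ((∑ y ∈ U, ℓ y * π y) + (∑ y ∈ U, ℓ y * σ y) + t * pv)) :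
    (∑ x ∈ U, ℓ x * (π x - pv * p x)) ^ 2 ≤
      4 * pv * ∑ x ∈ U, ∑ y ∈ U, ℓ x * ℓ y * (p x * σ y - ρ x y) := by
  set a := ∑ x ∈ U, ℓ x * p x with ha
  set pb := ∑ y ∈ U, ℓ y * π y with hpb
  set s := ∑ y ∈ U, ℓ y * σ y with hs
  set E := ∑ x ∈ U, ∑ y ∈ U, ℓ x * ℓ y * ρ x y with hE
  have hNeq : ∑ x ∈ U, ℓ x * (π x - pv * p x) = pb - pv * a := by
    rw [hpb, ha, Finset.mul_sum, ← Finset.sum_sub_distrib]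
    refine Finset.sum_congr rfl fun x _ => ?_
    ring
  have hΓeq : ∑ x ∈ U, ∑ y ∈ U, ℓ x * ℓ y * (p x * σ y - ρ x y) = a * s - E := by
    rw [ha, hs, hE, Finset.sum_mul_sum, ← Finset.sum_sub_distrib]
    refine Finset.sum_congr rfl fun x _ => ?_
    rw [← Finset.sum_sub_distrib]
    refine Finset.sum_congr rfl fun y _ => ?_
    ring
  have hq : ∀ t : ℝ, 0 ≤ pv * t ^ 2 + (a * pv + pb) * t + (a * (pb + s) - E) := by
    intro t
    have := hN1 t
    nlinarith [this]
  have hd := quad_nonneg_discr pv (a * pv + pb) (a * (pb + s) - E) hpv hq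
  rw [hNeq, hΓeq]
  nlinarith [hd]

/-- **(N1) for the pair (apex, `v`) implies (PV) at `v` with constant 4 (percolation form).**  If `0 < μ(S~v)` and, for every real `t`,
`Σ_{x,y} ℓ_xℓ_y μ(S~x ∩ v↔y ∩ S≁v) + t Σ_y ℓ_y μ(v↔y ∩ S≁v) ≤ (Σ_x ℓ_x μ(S~x) + t)·(Σ_y ℓ_y μ(S~v ∩ S~y) + Σ_y ℓ_y μ(v↔y ∩ S≁v) + t μ(S~v))`
— which is `E[ℓ(C_S)ℓ(C_v); S≁v] ≤ E[ℓ(C_S)]·E[ℓ(C_v)]` for the loads `ℓ` plus `t` on the glued apex, i.e. (N1) — then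
`N² ≤ 4 p_v Γ`, i.e. `Cov(1[S~v],A)² ≤ 4 μ(S~v)·(−Cov(A,Z_v))`. [this work] -/
theorem pv_four_of_n1 (ℓ : V → ℝ) (hpos : 0 < (prodBernoulli w).real (⋃ u ∈ S, (openConn u v : Set (BondConfig V))))
    (hN1 : ∀ t : ℝ,
      (∑ x, ∑ y, ℓ x * ℓ y * (prodBernoulli w).real ((⋃ u ∈ S, (openConn u x : Set (BondConfig V))) ∩ (openConn v y : Set (BondConfig V))
          ∩ (⋃ u ∈ S, (openConn u v : Set (BondConfig V)))ᶜ)) +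
        t * ∑ y, ℓ y * (prodBernoulli w).real ((openConn v y : Set (BondConfig V)) ∩ (⋃ u ∈ S, (openConn u v : Set (BondConfig V)))ᶜ) ≤
      ((∑ x, ℓ x * (prodBernoulli w).real (⋃ u ∈ S, (openConn u x : Set (BondConfig V)))) + t) *
        ((∑ y, ℓ y * (prodBernoulli w).real ((⋃ u ∈ S, (openConn u v : Set (BondConfig V))) ∩ ⋃ u ∈ S, (openConn u y : Set (BondConfig V)))) +
          (∑ y, ℓ y * (prodBernoulli w).real ((openConn v y : Set (BondConfig V)) ∩ (⋃ u ∈ S, (openConn u v : Set (BondConfig V)))ᶜ)) +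
          t * (prodBernoulli w).real (⋃ u ∈ S, (openConn u v : Set (BondConfig V))))) :
    (∑ x, ℓ x * ((prodBernoulli w).real ((⋃ u ∈ S, (openConn u v : Set (BondConfig V))) ∩
            (⋃ u ∈ S, (openConn u x : Set (BondConfig V)))) -
          (prodBernoulli w).real (⋃ u ∈ S, (openConn u v : Set (BondConfig V))) *
            (prodBernoulli w).real (⋃ u ∈ S, (openConn u x : Set (BondConfig V))))) ^ 2 ≤
      4 * (prodBernoulli w).real (⋃ u ∈ S, (openConn u v : Set (BondConfig V))) *
        ∑ x, ∑ y, ℓ x * ℓ y *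
          ((prodBernoulli w).real (⋃ u ∈ S, (openConn u x : Set (BondConfig V))) *
              (prodBernoulli w).real ((openConn v y : Set (BondConfig V)) ∩ (⋃ u ∈ S, (openConn u v : Set (BondConfig V)))ᶜ) -
            (prodBernoulli w).real ((⋃ u ∈ S, (openConn u x : Set (BondConfig V))) ∩ (openConn v y : Set (BondConfig V))
              ∩ (⋃ u ∈ S, (openConn u v : Set (BondConfig V)))ᶜ)) :=
  pv_four_of_n1_alg Finset.univ ℓ (fun x => (prodBernoulli w).real (⋃ u ∈ S, (openConn u x : Set (BondConfig V))))
    (fun y => (prodBernoulli w).real ((⋃ u ∈ S, (openConn u v : Set (BondConfig V))) ∩ ⋃ u ∈ S, (openConn u y : Set (BondConfig V))))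
    (fun y => (prodBernoulli w).real ((openConn v y : Set (BondConfig V)) ∩ (⋃ u ∈ S, (openConn u v : Set (BondConfig V)))ᶜ))
    (fun x y => (prodBernoulli w).real ((⋃ u ∈ S, (openConn u x : Set (BondConfig V))) ∩ (openConn v y : Set (BondConfig V))
      ∩ (⋃ u ∈ S, (openConn u v : Set (BondConfig V)))ᶜ))
    _ hpos hN1

end Perc

end APL

end Summit.CriticalPhenomena.PercolationContinuityZ3.Theorems
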